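import Mathlib.Geometry.Manifold.Riemannian.Basic
import Literature.Geometry.Lorentzian.LorentzianVolume
import Literature.Geometry.Riemannian.RiemannianDistance
import Literature.Topology.ParacompactSigmaCompact
import HarnessLib

/-!
# A connected Hausdorff manifold carrying a time-oriented Lorentzian metric is second countable
# (Geroch 1968)

R. Geroch, *Spinor structure of space-times in general relativity. I*, J. Math. Phys. 9 (1968)
1739–1744, Appendix: a connected Hausdorff manifold admitting a Lorentz metric is paracompact
(hence second countable) — the reason why no countability axiom has to be postulated for
spacetimes, and the step *"M̃ is second countable since it carries a Lorentzian metric"* in the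
construction of the maximal globally hyperbolic development as a union / quotient of developments
(Choquet-Bruhat–Geroch, Comm. Math. Phys. 14 (1969), proof of Thm. 3, the union of a chain of
developments; Sbierski, Ann. Henri Poincaré 17 (2016), §3.3; recorded as missing in
`Literature.Geometry.Lorentzian.CauchyProblemMGHDExistenceProofs`, § "What remains", item (a):
"second countability of the union from the Lorentzian metric plus time orientation, Geroch 1968").

We prove the **time-oriented case** (which is all that developments need, a time orientation
being part of the structure `Spacetime`), by the classical auxiliary-Riemannian-metric argument:

* `PseudoRiemannianMetric.IsRiemannian.sigmaCompactSpace`,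
  `PseudoRiemannianMetric.IsRiemannian.secondCountableTopology` — a connected, Hausdorff, locally
  compact manifold carrying a *Riemannian* `C^n` metric `g` on its tangent bundle is σ-compact and
  second countable: the Riemannian distance of `g` (Mathlib's `riemannianEDist` for the bundle
  structure `g.riemannianBundle`, `Literature.Geometry.Riemannian.RiemannianDistance`) is a
  pseudo-e-metric inducing the manifold topology (Gouëzel, `PseudoEMetricSpace.ofRiemannianMetric`),
  pseudo-e-metric spaces are paracompact (A. H. Stone; `EMetric.instParacompactSpace`), and a
  connected, locally compact, paracompact space is σ-compact (Bourbaki, TG I, §9, no. 10, Thm. 5;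
  `Literature.Topology.sigmaCompactSpace_of_paracompactSpace`); σ-compact charted spaces over a
  second countable model are second countable (`ChartedSpace.secondCountable_of_sigmaCompact`);
* `TimeOrientation.sigmaCompactSpace`, `TimeOrientation.secondCountableTopology` — the same for a
  manifold carrying a `C^n` Lorentzian metric `g` with a time orientation `τ`, applied to the
  Wick-rotated Riemannian metric `g_T = g - (2 / g(T,T)) T♭ ⊗ T♭`
  (`TimeOrientation.wickRotation`, `isRiemannian_wickRotation`, `LorentzianVolume`);
* `TimeOrientation.secondCountableTopology_euclidean` — the form used by developments: a connected
  Hausdorff `C^∞` manifold modelled on `ℝᵈ` with a time-oriented Lorentzian metric is second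
  countable, i.e. the countability field of `LorentzianManifold`/`Spacetime` is automatic.

All results proved; no definitions, no named facts.

## References

* R. Geroch, J. Math. Phys. 9 (1968) 1739–1744, Appendix. [Geroch1968JMP]
* N. Bourbaki, *General Topology, Chapters 1–4*, Springer 1989, Ch. I, §9, no. 10, Thm. 5.
  [BourbakiGT1]
* J. Sbierski, Ann. Henri Poincaré 17 (2016) 301–329 = arXiv:1309.7591, §3.3. [Sbierski2016AHP]
* B. O'Neill, *Semi-Riemannian geometry*, 1983, Ch. 5, Lemma 5.26 ff. (timecones; the auxiliary
  Riemannian metric). [ONeill1983]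
-/

noncomputable section

open Bundle Set Filter Manifold TopologicalSpace
open scoped Manifold ContDiff Topology

namespace Literature.Geometry.Lorentzian

variable {E : Type*} [NormedAddCommGroup E] [NormedSpace ℝ E] [FiniteDimensional ℝ E]
  {H : Type*} [TopologicalSpace H] {I : ModelWithCorners ℝ E H} {n : ℕ∞ω}
  {M : Type*} [TopologicalSpace M] [ChartedSpace H M] [IsManifold I ∞ M]

namespace PseudoRiemannianMetric

variable {g : PseudoRiemannianMetric I n E (TangentSpace I : M → Type _)}

/-- **A connected, Hausdorff, locally compact manifold carrying a Riemannian metric is σ-compact.**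
The Riemannian distance of `g` is a pseudo-e-metric inducing the manifold topology
(`PseudoEMetricSpace.ofRiemannianMetric` for `g.riemannianBundle hg`); pseudo-e-metric spaces are
paracompact, and connected locally compact paracompact spaces are σ-compact
(`Literature.Topology.sigmaCompactSpace_of_paracompactSpace`, Bourbaki TG I §9.10 Thm. 5).
[cite: Geroch1968JMP, Appendix] [cite: BourbakiGT1, Ch. I §9 no. 10 Thm. 5] -/
theorem IsRiemannian.sigmaCompactSpace [T2Space M] [LocallyCompactSpace M] [ConnectedSpace M]
    (hg : g.IsRiemannian) : SigmaCompactSpace M := by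
  letI := g.riemannianBundle hg
  haveI := g.isContinuousRiemannianBundle hg
  letI : PseudoEMetricSpace M := .ofRiemannianMetric I M
  exact Literature.Topology.sigmaCompactSpace_of_paracompactSpace M

/-- **A connected, Hausdorff, locally compact manifold over a second countable model carrying a
Riemannian metric is second countable** (σ-compact by `IsRiemannian.sigmaCompactSpace`, then
`ChartedSpace.secondCountable_of_sigmaCompact`). [cite: Geroch1968JMP, Appendix] -/
theorem IsRiemannian.secondCountableTopology [T2Space M] [LocallyCompactSpace M] [ConnectedSpace M]
    [SecondCountableTopology H] (hg : g.IsRiemannian) : SecondCountableTopology M := by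
  haveI := hg.sigmaCompactSpace
  exact ChartedSpace.secondCountable_of_sigmaCompact H M

end PseudoRiemannianMetric

namespace TimeOrientation

variable {g : LorentzianMetric I n M}

/-- **Geroch 1968 (time-oriented case): a connected, Hausdorff, locally compact manifold carrying a
Lorentzian metric with a time orientation is σ-compact** — apply
`PseudoRiemannianMetric.IsRiemannian.sigmaCompactSpace` to the Wick-rotated Riemannian metric
`g_T = g - (2/g(T,T)) T♭ ⊗ T♭` (`wickRotation`, `isRiemannian_wickRotation`).
[cite: Geroch1968JMP, Appendix] -/
theorem sigmaCompactSpace [T2Space M] [LocallyCompactSpace M] [ConnectedSpace M]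
    (τ : TimeOrientation g) : SigmaCompactSpace M :=
  PseudoRiemannianMetric.IsRiemannian.sigmaCompactSpace τ.isRiemannian_wickRotation

/-- **Geroch 1968 (time-oriented case): a connected, Hausdorff, locally compact manifold over a
second countable model carrying a Lorentzian metric with a time orientation is second countable.**
"Since M carries a Lorentzian metric it is paracompact" — the countability step of the union /
quotient constructions of developments (Choquet-Bruhat–Geroch 1969, proof of Thm. 3; Sbierski 2016,
§3.3). [cite: Geroch1968JMP, Appendix] [cite: Sbierski2016AHP, §3.3] -/
theorem secondCountableTopology [T2Space M] [LocallyCompactSpace M] [ConnectedSpace M]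
    [SecondCountableTopology H] (τ : TimeOrientation g) : SecondCountableTopology M :=
  PseudoRiemannianMetric.IsRiemannian.secondCountableTopology τ.isRiemannian_wickRotation

end TimeOrientation

/-- **Every connected Hausdorff time-oriented Lorentzian `C^∞` manifold modelled on `ℝᵈ` is second
countable** — the `secondCountableTopology` field of `LorentzianManifold` / `Spacetime` is implied
by the other fields plus the time orientation (local compactness from the charts,
`ChartedSpace.locallyCompactSpace`). Geroch 1968, Appendix. [cite: Geroch1968JMP, Appendix] -/
theorem TimeOrientation.secondCountableTopology_euclidean {d : ℕ} {n : ℕ∞ω} {M : Type*}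
    [TopologicalSpace M] [ChartedSpace (EuclideanSpace ℝ (Fin d)) M] [IsManifold (𝓡 d) ∞ M]
    [T2Space M] [ConnectedSpace M] {g : LorentzianMetric (𝓡 d) n M} (τ : TimeOrientation g) :
    SecondCountableTopology M := by
  haveI : LocallyCompactSpace M := ChartedSpace.locallyCompactSpace (EuclideanSpace ℝ (Fin d)) M
  exact τ.secondCountableTopology

/-- The σ-compact form of the previous statement: every connected Hausdorff time-oriented
Lorentzian `C^∞` manifold modelled on `ℝᵈ` is σ-compact. Geroch 1968, Appendix.
[cite: Geroch1968JMP, Appendix] -/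
theorem TimeOrientation.sigmaCompactSpace_euclidean {d : ℕ} {n : ℕ∞ω} {M : Type*}
    [TopologicalSpace M] [ChartedSpace (EuclideanSpace ℝ (Fin d)) M] [IsManifold (𝓡 d) ∞ M]
    [T2Space M] [ConnectedSpace M] {g : LorentzianMetric (𝓡 d) n M} (τ : TimeOrientation g) :
    SigmaCompactSpace M := by
  haveI : LocallyCompactSpace M := ChartedSpace.locallyCompactSpace (EuclideanSpace ℝ (Fin d)) M
  exact τ.sigmaCompactSpace

end Literature.Geometry.Lorentzian

end
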